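import Summits.BirchSwinnertonDyer.BirchSwinnertonDyer.Theorems.SignedLowerHalvesSmallImageLowerHalfBothSignsRttCharRoadE2JunctionJ2OfZeta
import Summits.BirchSwinnertonDyer.BirchSwinnertonDyer.Theorems.SignedLowerHalvesSmallImageLowerHalfBothSignsRttD2SeqJ3StrictCarrier
import Summits.BirchSwinnertonDyer.BirchSwinnertonDyer.Theorems.SignedLowerHalvesSmallImageLowerHalfBothSignsRttD2SeqE2OfTails
import Summits.BirchSwinnertonDyer.BirchSwinnertonDyer.Theorems.SignedLowerHalvesSmallImageLowerHalfBothSignsRttE2NumHeadlinePlaces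
import Summits.BirchSwinnertonDyer.BirchSwinnertonDyer.Theorems.SignedLowerHalvesSmallImageLowerHalfBothSignsRttCharRoadE2GlueAlgebra
import Summits.BirchSwinnertonDyer.Rank1Residual.X2.EulerFactorInvariants
import Summits.BirchSwinnertonDyer.BirchSwinnertonDyer.Theorems.SignedLowerHalvesSmallImageLowerHalfBothSignsRttOneSidedCruxThetaPartner
import Summits.BirchSwinnertonDyer.BirchSwinnertonDyer.Theorems.SignedLowerHalvesSmallImageLowerHalfBothSignsRttCharRoad
import Summits.BirchSwinnertonDyer.BirchSwinnertonDyer.Theorems.SignedLowerHalvesSmallImageLowerHalfBothSignsRttCharRoadJGlue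
import Summits.BirchSwinnertonDyer.BirchSwinnertonDyer.Theorems.SignedLowerHalvesSmallImageLowerHalfBothSignsRttCharRoadE1Algebra
import Summits.BirchSwinnertonDyer.BirchSwinnertonDyer.Theorems.SignedLowerHalvesSmallImageLowerHalfBothSignsRttCharRoadE1OfInjTop
import Summits.BirchSwinnertonDyer.BirchSwinnertonDyer.Theorems.SignedLowerHalvesSmallImageLowerHalfBothSignsRttCharRoadE1InjTop
import Summits.BirchSwinnertonDyer.BirchSwinnertonDyer.Theorems.SignedLowerHalvesSmallImageLowerHalfBothSignsRttCharRoadCurveJcurveClosed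
import Summits.BirchSwinnertonDyer.BirchSwinnertonDyer.Theorems.SignedLowerHalvesSmallImageLowerHalfBothSignsRttKanThetaLayerLambda
import Summits.BirchSwinnertonDyer.BirchSwinnertonDyer.Theorems.SignedLowerHalvesSmallImageLowerHalfBothSignsRttD2SeqE2DepletedJunctionTails
import Summits.BirchSwinnertonDyer.BirchSwinnertonDyer.Theorems.SignedLowerHalvesSmallImageLowerHalfBothSignsRttD2TwistSkeleton
import Summits.BirchSwinnertonDyer.BirchSwinnertonDyer.Theorems.SignedLowerHalvesSmallImageLowerHalfBothSignsRttD2J2Specialisation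
import Summits.BirchSwinnertonDyer.BirchSwinnertonDyer.Theorems.SignedLowerHalvesSmallImageLowerHalfBothSignsRttCharRoadE2JunctionFinite
import Summits.BirchSwinnertonDyer.BirchSwinnertonDyer.Theorems.SignedLowerHalvesSmallImageLowerHalfBothSignsRttD2OTwistedIwasawaDataExist
import Summits.BirchSwinnertonDyer.BirchSwinnertonDyer.Theorems.SignedLowerHalvesSmallImageLowerHalfBothSignsRttCharRoadFrame4
import Summits.BirchSwinnertonDyer.BirchSwinnertonDyer.Theorems.SignedLowerHalvesSmallImageLowerHalfBothSignsRttCharRoadFrame5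
import Summits.BirchSwinnertonDyer.BirchSwinnertonDyer.Theorems.SignedLowerHalvesSmallImageLowerHalfBothSignsRttD2J2Phi0Ker
import Summits.BirchSwinnertonDyer.BirchSwinnertonDyer.Theorems.SignedLowerHalvesSmallImageLowerHalfBothSignsRttFrameLayers
import Summits.BirchSwinnertonDyer.BirchSwinnertonDyer.Theorems.SignedLowerHalvesSmallImageLowerHalfBothSignsRttD2TFPinned
import Summits.BirchSwinnertonDyer.BirchSwinnertonDyer.Theorems.SignedLowerHalvesSmallImageLowerHalfBothSignsRttJunctionLambdaStrictDual
import Summits.BirchSwinnertonDyer.BirchSwinnertonDyer.Theorems.SignedLowerHalvesSmallImageLowerHalfBothSignsRttJunctionLambdaLocImageLambda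
import Summits.BirchSwinnertonDyer.BirchSwinnertonDyer.Theorems.SignedLowerHalvesSmallImageLowerHalfBothSignsRttJunctionDepletion
import Summits.BirchSwinnertonDyer.BirchSwinnertonDyer.Theorems.SignedLowerHalvesSmallImageLowerHalfBothSignsRttD2SeqJ3HS2Frame
import Summits.BirchSwinnertonDyer.BirchSwinnertonDyer.Theorems.SignedLowerHalvesSmallImageLowerHalfBothSignsRttD2SeqJ3HJv
import Summits.BirchSwinnertonDyer.BirchSwinnertonDyer.Theorems.SignedLowerHalvesSmallImageLowerHalfBothSignsRttD2SeqJ3HS2Plumb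
import Summits.BirchSwinnertonDyer.BirchSwinnertonDyer.Theorems.SignedLowerHalvesSmallImageLowerHalfBothSignsRttJunctionLocalNs
import Summits.BirchSwinnertonDyer.BirchSwinnertonDyer.Theorems.SignedLowerHalvesSmallImageLowerHalfBothSignsRttJunctionEulerId
import Summits.BirchSwinnertonDyer.BirchSwinnertonDyer.Theorems.SignedLowerHalvesSmallImageLowerHalfBothSignsRttJunctionShaOfPi
import Summits.BirchSwinnertonDyer.BirchSwinnertonDyer.Theorems.SignedLowerHalvesSmallImageLowerHalfBothSignsRttJunctionShaPiCofree
import Literature.NumberTheory.EllipticCurves.KimPark2017.PlusMinusUniversalNorms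
import Summits.BirchSwinnertonDyer.BirchSwinnertonDyer.Theorems.SignedLowerHalvesSmallImageLowerHalfBothSignsRttD2SeqSemilocOfGen
import Summits.BirchSwinnertonDyer.BirchSwinnertonDyer.Theorems.SignedLowerHalvesSmallImageLowerHalfBothSignsRttD2SeqSemilocJunctionPT
import Summits.BirchSwinnertonDyer.BirchSwinnertonDyer.Theorems.SignedLowerHalvesSmallImageLowerHalfBothSignsRttJunctionShaLocCountSerre
import Summits.BirchSwinnertonDyer.BirchSwinnertonDyer.Theorems.SignedLowerHalvesSmallImageLowerHalfBothSignsRttReciprocityUniqueRelay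
import Summits.BirchSwinnertonDyer.BirchSwinnertonDyer.Theorems.SignedLowerHalvesSmallImageLowerHalfBothSignsRttRecipMTOfValuesMT
import Summits.BirchSwinnertonDyer.BirchSwinnertonDyer.Theorems.SignedLowerHalvesSmallImageLowerHalfBothSignsRttRecipMTOfValuesAlg
import Summits.BirchSwinnertonDyer.BirchSwinnertonDyer.Theorems.SignedLowerHalvesSmallImageLowerHalfBothSignsRttJunctionRecipValuesOfF1
import Summits.BirchSwinnertonDyer.BirchSwinnertonDyer.Theorems.SignedLowerHalvesSmallImageLowerHalfBothSignsRttF1CMRealityTwoSided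
import Summits.BirchSwinnertonDyer.BirchSwinnertonDyer.Theorems.SignedLowerHalvesSmallImageLowerHalfBothSignsRttCharRoadSharp
import Summits.BirchSwinnertonDyer.BirchSwinnertonDyer.Theorems.SignedLowerHalvesSmallImageLowerHalfBothSignsRttCharRoadFrame6
import Summits.BirchSwinnertonDyer.BirchSwinnertonDyer.Theorems.SignedLowerHalvesSmallImageLowerHalfBothSignsRttCharRoadFrame7
import Summits.BirchSwinnertonDyer.BirchSwinnertonDyer.Theorems.SignedLowerHalvesSmallImageLowerHalfBothSignsRttOneSidedCruxThetaPartnerSharp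
import Summits.BirchSwinnertonDyer.BirchSwinnertonDyer.Theorems.SignedLowerHalvesSmallImageLowerHalfBothSignsRttCharRoadJGlueSharp
import Summits.BirchSwinnertonDyer.BirchSwinnertonDyer.Theorems.SignedLowerHalvesSmallImageLowerHalfBothSignsRttColemanContentCofree
import Literature.NumberTheory.EllipticCurves.KimPark2017.SignedNormSystemLogSums
import Literature.NumberTheory.EllipticCurves.Kato2004.KummerFrameOfTorsionTower
import Literature.NumberTheory.EllipticCurves.CMNewformGamma0EulerFactorsPadicCharacter
import Literature.NumberTheory.EllipticCurves.CMNewformGamma0EulerFactorsPadicCharacterProofsResidual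
import Literature.NumberTheory.EllipticCurves.CMNewformGamma0ResidualOfBadProofs
import Literature.NumberTheory.EllipticCurves.KimPark2017.SignedLocalDualUnramifiedQuadratic
import Literature.NumberTheory.EllipticCurves.CanonicalPeriodSymbolCongruence
import Literature.NumberTheory.EllipticCurves.NewformGaloisRepArtinConductor
import Literature.NumberTheory.EllipticCurves.HasseWeilAbelianConductorOggSaito
import Literature.NumberTheory.EllipticCurves.BDKim2009.SignedSelmerCongruentLambdaInvariant
import Literature.NumberTheory.EllipticCurves.PollackRubin2004.SignedMainTheoremCM
import Literature.NumberTheory.EllipticCurves.CuspFormLFunction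
import HarnessLib
import HarnessLib

/-!
# PORT P1 (LEAD `cruxlead-stmt-BirchSwinnertonDyer-23599` g16): row S2 = J3 — Poitou–Tate exactness on the strict carrier (`junctionExact_ns`) + the λ-monotonicity glue

Line `rtt_w3` of crux L `SmallImageLowerHalfBothSigns` (item stmt-BirchSwinnertonDyer-23599), file 1 of the port of the line file's kernel rows into `Theorems/` with the line-file
predicates unfolded. THEOREMS ONLY, no `sorry`, no new definition; BSD / crux L are NOT proved by this file.
-/

set_option autoImplicit false
-- D-0017: single-problem summit, the namespace repeats the problem name by design.
set_option linter.dupNamespace false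
noncomputable section

open scoped Classical MatrixGroups ModularForm BigOperators Pointwise

namespace Summit.BirchSwinnertonDyer.BirchSwinnertonDyer.Theorems.SmallImageRttLine

open CongruenceSubgroup WeierstrassCurve Field Polynomial NumberField IsDedekindDomain Matrix
  Literature.NumberTheory.GaloisRepresentations Literature.NumberTheory.LFunctions
  Literature.NumberTheory.GaloisRepresentations.HeckeCharacter Literature.NumberTheory.Automorphic
  Summit.BirchSwinnertonDyer.BirchSwinnertonDyer.Theorems.HeckeThetaPartner Summit.BirchSwinnertonDyer.Rank1Residual
  Literature.NumberTheory.EllipticCurves Literature.NumberTheory.EllipticCurves.ModularForms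
  Literature.NumberTheory.EllipticCurves.Rank1Residual
  Literature.NumberTheory.EllipticCurves.Kobayashi2003
  Literature.NumberTheory.EllipticCurves.GreenbergVatsal2000 ZpExtension
  Literature.NumberTheory.IwasawaTheory Rat.HeightOneSpectrum
  Summit.BirchSwinnertonDyer.Rank1Residual.Supersingular
  Summit.BirchSwinnertonDyer.Rank1Residual.X1.MuLambda
  Summit.BirchSwinnertonDyer.BirchSwinnertonDyer.Theorems.SmallImageLambdaLowerThreeNsThetaTransport
  Summit.BirchSwinnertonDyer.BirchSwinnertonDyer.Theorems

set_option maxHeartbeats 4000000 in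
/-- **PORT (LEAD g16) of row S3-glue of the line file `Cruxes/SmallImageLowerHalfBothSigns/Lines/rtt_w3.lean` (v46, registered 74b28541a9c1) into the
THEOREMS tree**, with the line-file predicates (`CharRoadFrameProps`, `CharRoadFrameSupp`, `CharRoad*`, `Junction*`) UNFOLDED textually (generator
`gen_port.py`; the proof is the line file's, verbatim). `CharRoadLambda` is monotone in its numerical parameter. Helper `--supports
stmt-BirchSwinnertonDyer-23599`; CONDITIONAL on its displayed print-fact premises; closes nothing; crux L / BSD are NOT proved by this. -/
theorem charRoadLambda_mono
    {p : ℕ} [Fact p.Prime] {hp : p ≠ 2} {κ : ZpExtension ℚ p} {hκ : κ.IsCyclotomic} {K : Type} [Field K] [NumberField K] {hK2 : Module.finrank ℚ K = 2} {hnd : ¬ (p : ℤ) ∣ NumberField.discr K} {S : Set (PadicAlgCl p)} {hS : 0 < Module.finrank ℚ_[p] (padicCoeffField S)} {θ : FramedGaloisRep K ↥(padicCoeffIntegers S) 1} {W : WeierstrassCurve ℚ} {j : (W.baseChange K).geomPrimaryTorsion p →+ GreenbergSelmer.Cofree θ (padicCoeffField S)} {ε : ℤˣ} {γK : absoluteGaloisGroup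 K}
    {hγK : (κ.restrictOfFinrankEqTwo hp K hK2).IsTopGenerator γK} {S₀ : Finset (HeightOneSpectrum (𝓞 ℚ))} {Dψ : SmallImageCharSignedSelmer.SignedTransportDualDataSat (κ.restrictOfFinrankEqTwo hp K hK2) γK (GreenbergSelmer.Cofree θ (padicCoeffField S)) ↥(padicCoeffIntegers S) (W.baseChange K) j {w : HeightOneSpectrum (𝓞 K) | ∃ v ∈ S₀, ((natGenerator v : ℕ) : 𝓞 K) ∈ w.asIdeal} ε} {vp : HeightOneSpectrum (𝓞 K)} {hv : vp.asIdeal = Ideal.span {((p : ℕ) : 𝓞 K)}}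
    {θ' : absoluteGaloisGroup K →ₜ* (↥(padicCoeffIntegers S))ˣ} {𝔣 : Ideal (𝓞 K)} {I : SmallImageRttD2J1.CycIwasawaCohomologyDataO S (κ.restrictOfFinrankEqTwo hp K hK2) γK⁻¹ θ' (Literature.NumberTheory.ComplexMultiplication.EllipticUnits.JohnsonLeungKings2011.suppPF p 𝔣) 1} {E : IwasawaAlgebraO S} {a b : ℕ} (h :
        (letI := SmallImageRttD2Seq.localAction (closureEmb (K := K) (vp.adicCompletion K)) (GreenbergSelmer.Cofree θ (padicCoeffField S)) ;
        haveI := SmallImageRttD2Seq.smulCommClass_localAction (R := padicCoeffIntegers S) (GreenbergSelmer.Cofree θ (padicCoeffField S)) vp ;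
        letI : Algebra (IwasawaAlgebra p) (IwasawaAlgebraO S) := (iwasawaToIwasawaO S).toAlgebra ;
        haveI : FiniteDimensional ℚ_[p] (padicCoeffField S) := Module.finite_of_finrank_pos hS ;
        letI := I.moduleIwasawa ;
        haveI := I.isScalarTower_moduleIwasawa ; ∀ (γv : absoluteGaloisGroup (vp.adicCompletion K)) (hγv : (κ.restrictOfFinrankEqTwo hp K hK2).IsTopGenerator (resGalOfEmb (closureEmb (K := K) (vp.adicCompletion K)) γv)) (DQ : SmallImageRttD2Seq.LocalCondDualData (κ.restrictOfFinrankEqTwo hp K hK2) (GreenbergSelmer.Cofree θ (padicCoeffField S)) ↥(padicCoeffIntegers S) (W.baseChange K) j ε vp γv)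
          (instX : Module (IwasawaAlgebraO S) Dψ.X) (instQ : Module (IwasawaAlgebraO S) DQ.X) (hιX : ∀ (f : IwasawaAlgebra p) (x : Dψ.X), (letI := instX; iwasawaToIwasawaO S f • x) = f • x) (hιQ : ∀ (f : IwasawaAlgebra p) (x : DQ.X), (letI := instQ; iwasawaToIwasawaO S f • x) = f • x) (hCX : ∀ (a₁ : ↥(padicCoeffIntegers S)) (x : Dψ.X)
              (s₁ : SmallImageCharSignedSelmer.signedTransportSelmerInftySat (κ.restrictOfFinrankEqTwo hp K hK2) (GreenbergSelmer.Cofree θ (padicCoeffField S)) ↥(padicCoeffIntegers S) (W.baseChange K) j {w : HeightOneSpectrum (𝓞 K) | ∃ v ∈ S₀, ((natGenerator v : ℕ) : 𝓞 K) ∈ w.asIdeal} ε), Dψ.toDual (letI := instX; (PowerSeries.C a₁ : IwasawaAlgebraO S) • x) s₁ = Dψ.toDual x ⟨GreenbergSelmer.scalarH1 _ _ a₁ s₁,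
                SmallImageCharSignedSelmer.scalarH1_mem_signedTransportSelmerInftySat _ _ ↥(padicCoeffIntegers S) (W.baseChange K) j {w : HeightOneSpectrum (𝓞 K) | ∃ v ∈ S₀, ((natGenerator v : ℕ) : 𝓞 K) ∈ w.asIdeal} ε a₁ s₁.2⟩) (hCQ : ∀ (a₁ : ↥(padicCoeffIntegers S)) (x : DQ.X) (c : SmallImageRttD2Seq.localCondInftySat (κ.restrictOfFinrankEqTwo hp K hK2) (GreenbergSelmer.Cofree θ (padicCoeffField S)) ↥(padicCoeffIntegers S) (W.baseChange K) j ε vp),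
            DQ.toDual (letI := instQ; (PowerSeries.C a₁ : IwasawaAlgebraO S) • x) c = DQ.toDual x (SmallImageRttD2Seq.scalarLocalSat _ _ ↥(padicCoeffIntegers S) (W.baseChange K) j ε vp a₁ c)),
          letI := instX; letI := instQ ;
          haveI : IsScalarTower (IwasawaAlgebra p) (IwasawaAlgebraO S) Dψ.X := SmallImageRttCharRoad.isScalarTower_iwasawaAlgebraO_of_smul_eq S (fun _ ↦ rfl) hιX ;
          haveI : IsScalarTower (IwasawaAlgebra p) (IwasawaAlgebraO S) DQ.X := SmallImageRttCharRoad.isScalarTower_iwasawaAlgebraO_of_smul_eq S (fun _ ↦ rfl) hιQ ;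
          let gX := SmallImageRttD2Seq.gXLinearMapO S Dψ DQ (fun _ _ ↦ rfl) (SmallImageRttD2Seq.natCast_mem_asIdeal_of_eq_span hv) instX instQ hιX hιQ hCX hCQ (GreenbergSelmer.exists_pow_smul_cofree_eq_zero S θ) (GreenbergSelmer.isOpen_stabilizer_cofree S θ) (SmallImageRttD2Seq.isOpen_stabilizer_of_hres (GreenbergSelmer.Cofree θ (padicCoeffField S)) vp (fun _ _ ↦ rfl) (GreenbergSelmer.isOpen_stabilizer_cofree S θ)) hγK
                (SmallImageRttD2Seq.isNonsplitIn_restrictOfFinrankEqTwo hp hκ K hK2 hnd (SmallImageRttD2Seq.natCast_mem_asIdeal_of_eq_span hv)) hγv; a + lambdaInvariant p (IwasawaAlgebraO S ⧸ Ideal.span {E}) ≤ lambdaInvariant p (Dψ.X ⧸ LinearMap.range gX) + lambdaInvariant p (I.H ⧸ LinearMap.range (Submodule.subtype (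
                    (SmallImageRttD2Seq.strictCarrier I (SmallImageRttD2Seq.strictLevel S (κ.restrictOfFinrankEqTwo hp K hK2) θ' (Literature.NumberTheory.ComplexMultiplication.EllipticUnits.JohnsonLeungKings2011.suppPF p 𝔣) {w : HeightOneSpectrum (𝓞 K) | ∃ v ∈ S₀, ((natGenerator v : ℕ) : 𝓞 K) ∈ w.asIdeal})
                      (fun n k f _ hy ↦ SmallImageRttD2Seq.smul_mem_strictLevel S (κ.restrictOfFinrankEqTwo hp K hK2) θ' (Literature.NumberTheory.ComplexMultiplication.EllipticUnits.JohnsonLeungKings2011.suppPF p 𝔣) {w : HeightOneSpectrum (𝓞 K) | ∃ v ∈ S₀, ((natGenerator v : ℕ) : 𝓞 K) ∈ w.asIdeal} γK⁻¹ n k f hy))))))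
        ) (hba : b ≤ a) :
            (letI := SmallImageRttD2Seq.localAction (closureEmb (K := K) (vp.adicCompletion K)) (GreenbergSelmer.Cofree θ (padicCoeffField S)) ;
            haveI := SmallImageRttD2Seq.smulCommClass_localAction (R := padicCoeffIntegers S) (GreenbergSelmer.Cofree θ (padicCoeffField S)) vp ;
            letI : Algebra (IwasawaAlgebra p) (IwasawaAlgebraO S) := (iwasawaToIwasawaO S).toAlgebra ;
            haveI : FiniteDimensional ℚ_[p] (padicCoeffField S) := Module.finite_of_finrank_pos hS ;
            letI := I.moduleIwasawa ;
            haveI := I.isScalarTower_moduleIwasawa ; ∀ (γv : absoluteGaloisGroup (vp.adicCompletion K)) (hγv : (κ.restrictOfFinrankEqTwo hp K hK2).IsTopGenerator (resGalOfEmb (closureEmb (K := K) (vp.adicCompletion K)) γv)) (DQ : SmallImageRttD2Seq.LocalCondDualData (κ.restrictOfFinrankEqTwo hp K hK2) (GreenbergSelmer.Cofree θ (padicCoeffField S)) ↥(padicCoeffIntegers S) (W.baseChange K) j ε vp γv)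
              (instX : Module (IwasawaAlgebraO S) Dψ.X) (instQ : Module (IwasawaAlgebraO S) DQ.X) (hιX : ∀ (f : IwasawaAlgebra p) (x : Dψ.X), (letI := instX; iwasawaToIwasawaO S f • x) = f • x) (hιQ : ∀ (f : IwasawaAlgebra p) (x : DQ.X), (letI := instQ; iwasawaToIwasawaO S f • x) = f • x) (hCX : ∀ (a₁ : ↥(padicCoeffIntegers S)) (x : Dψ.X)
                  (s₁ : SmallImageCharSignedSelmer.signedTransportSelmerInftySat (κ.restrictOfFinrankEqTwo hp K hK2) (GreenbergSelmer.Cofree θ (padicCoeffField S)) ↥(padicCoeffIntegers S) (W.baseChange K) j {w : HeightOneSpectrum (𝓞 K) | ∃ v ∈ S₀, ((natGenerator v : ℕ) : 𝓞 K) ∈ w.asIdeal} ε), Dψ.toDual (letI := instX; (PowerSeries.C a₁ : IwasawaAlgebraO S) • x) s₁ = Dψ.toDual x ⟨GreenbergSelmer.scalarH1 _ _ a₁ s₁,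
                    SmallImageCharSignedSelmer.scalarH1_mem_signedTransportSelmerInftySat _ _ ↥(padicCoeffIntegers S) (W.baseChange K) j {w : HeightOneSpectrum (𝓞 K) | ∃ v ∈ S₀, ((natGenerator v : ℕ) : 𝓞 K) ∈ w.asIdeal} ε a₁ s₁.2⟩) (hCQ : ∀ (a₁ : ↥(padicCoeffIntegers S)) (x : DQ.X) (c : SmallImageRttD2Seq.localCondInftySat (κ.restrictOfFinrankEqTwo hp K hK2) (GreenbergSelmer.Cofree θ (padicCoeffField S)) ↥(padicCoeffIntegers S) (W.baseChange K) j ε vp),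
                DQ.toDual (letI := instQ; (PowerSeries.C a₁ : IwasawaAlgebraO S) • x) c = DQ.toDual x (SmallImageRttD2Seq.scalarLocalSat _ _ ↥(padicCoeffIntegers S) (W.baseChange K) j ε vp a₁ c)),
              letI := instX; letI := instQ ;
              haveI : IsScalarTower (IwasawaAlgebra p) (IwasawaAlgebraO S) Dψ.X := SmallImageRttCharRoad.isScalarTower_iwasawaAlgebraO_of_smul_eq S (fun _ ↦ rfl) hιX ;
              haveI : IsScalarTower (IwasawaAlgebra p) (IwasawaAlgebraO S) DQ.X := SmallImageRttCharRoad.isScalarTower_iwasawaAlgebraO_of_smul_eq S (fun _ ↦ rfl) hιQ ;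
              let gX := SmallImageRttD2Seq.gXLinearMapO S Dψ DQ (fun _ _ ↦ rfl) (SmallImageRttD2Seq.natCast_mem_asIdeal_of_eq_span hv) instX instQ hιX hιQ hCX hCQ (GreenbergSelmer.exists_pow_smul_cofree_eq_zero S θ) (GreenbergSelmer.isOpen_stabilizer_cofree S θ) (SmallImageRttD2Seq.isOpen_stabilizer_of_hres (GreenbergSelmer.Cofree θ (padicCoeffField S)) vp (fun _ _ ↦ rfl) (GreenbergSelmer.isOpen_stabilizer_cofree S θ)) hγK
                    (SmallImageRttD2Seq.isNonsplitIn_restrictOfFinrankEqTwo hp hκ K hK2 hnd (SmallImageRttD2Seq.natCast_mem_asIdeal_of_eq_span hv)) hγv; b + lambdaInvariant p (IwasawaAlgebraO S ⧸ Ideal.span {E}) ≤ lambdaInvariant p (Dψ.X ⧸ LinearMap.range gX) + lambdaInvariant p (I.H ⧸ LinearMap.range (Submodule.subtype (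
                        (SmallImageRttD2Seq.strictCarrier I (SmallImageRttD2Seq.strictLevel S (κ.restrictOfFinrankEqTwo hp K hK2) θ' (Literature.NumberTheory.ComplexMultiplication.EllipticUnits.JohnsonLeungKings2011.suppPF p 𝔣) {w : HeightOneSpectrum (𝓞 K) | ∃ v ∈ S₀, ((natGenerator v : ℕ) : 𝓞 K) ∈ w.asIdeal})
                          (fun n k f _ hy ↦ SmallImageRttD2Seq.smul_mem_strictLevel S (κ.restrictOfFinrankEqTwo hp K hK2) θ' (Literature.NumberTheory.ComplexMultiplication.EllipticUnits.JohnsonLeungKings2011.suppPF p 𝔣) {w : HeightOneSpectrum (𝓞 K) | ∃ v ∈ S₀, ((natGenerator v : ℕ) : 𝓞 K) ∈ w.asIdeal} γK⁻¹ n k f hy)))))) := by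
  intro γv hγv DQ instX instQ hιX hιQ hCX hCQ
  have h1 := h γv hγv DQ instX instQ hιX hιQ hCX hCQ
  intro gX
  exact le_trans (Nat.add_le_add_right hba _) h1

set_option maxHeartbeats 4000000 in
/-- **PORT (LEAD g16) of row S2 (J3) of the line file `Cruxes/SmallImageLowerHalfBothSigns/Lines/rtt_w3.lean` (v46, registered 74b28541a9c1) into the
THEOREMS tree**, with the line-file predicates (`CharRoadFrameProps`, `CharRoadFrameSupp`, `CharRoad*`, `Junction*`) UNFOLDED textually (generator
`gen_port.py`; the proof is the line file's, verbatim). Poitou–Tate exactness `Function.Exact (jv ∘ B′.subtype) gX` on the strict carrier for every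
perfect `λ` and every pinned junction map (-w3 g24 H7f/H7h, p804012/p807655). Helper `--supports stmt-BirchSwinnertonDyer-23599`; CONDITIONAL on its
displayed print-fact premises; closes nothing; crux L / BSD are NOT proved by this. [cite: Kobayashi2003, Thm. 7.3 i)] [cite: Rubin2000, Thm. 1.7.3,
§4.2] [cite: NeukirchSchmidtWingberg2008, VIII §6, (7.2.6)] [cite: Kato2004Asterisque, §17.13] [cite: Washington1997, Prop. 13.2] -/
theorem junctionExact_ns :
    KimPark2017.prop212_prop33_localSignedDual_free_rank_two → (∀ (W : WeierstrassCurve ℚ) [W.IsElliptic] [W.IsGloballyMinimal] (p : ℕ) [Fact p.Prime], ∀ (hp : p ≠ 2), ClassX7 W p → ¬ W.HasCM → W.frobeniusTrace p = 0 → ¬ Surj W p → ¬ (∃ (A : WeierstrassCurve ℚ) (_ : A.IsElliptic) (_ : A.IsGloballyMinimal), A.HasCM ∧ GoodSS A p ∧ A.frobeniusTrace p = 0 ∧ ∃ e : geomTorsion W (p : ℤ) ≃+ geomTorsion A (p : ℤ),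
                ∀ (σ : absoluteGaloisGroup ℚ) (P : geomTorsion W (p : ℤ)), e (σ • P) = σ • e P) → ¬ (∃ (A : WeierstrassCurve ℚ) (_ : A.IsElliptic) (_ : A.IsGloballyMinimal) (t : ℚ), A.HasGoodReductionAtPrime p ∧ A.frobeniusTrace p = 0 ∧ (∃ e : geomTorsion W (p : ℤ) ≃+ geomTorsion A (p : ℤ), ∀ (σ : absoluteGaloisGroup ℚ) (P : geomTorsion W (p : ℤ)), e (σ • P) = σ • e P) ∧ A.entireLFunction 1 / (A.realPeriodRat : ℂ) = ((t : ℚ) : ℂ) ∧ t ≠ 0 ∧ padicValRat p t = 0) →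
          ∀ (ε : ℤˣ) (K : Type) [Field K] [NumberField K] (σK : K →+* ℂ) (𝔪 : Ideal (𝓞 K)) (ψ : HeightOneSpectrum (𝓞 K) → ℂ) (e : PadicAlgCl p ≃+* ℂ), ∀ (hK2 : Module.finrank ℚ K = 2), IsTotallyComplex K → 𝔪 ≠ ⊥ → (∀ I : Ideal (𝓞 K), Ideal.absNorm I ≠ p) → ¬ p ∣ (NumberField.discr K).natAbs * Ideal.absNorm 𝔪 → (∀ (ℓ : ℕ) [Fact ℓ.Prime], ℓ ∣ (NumberField.discr K).natAbs * Ideal.absNorm 𝔪 → ¬ W.HasGoodReductionAtPrime ℓ) → IsGrossencharakter 𝔪 (embType σK) (embTypeConj σK) ψ →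
            (∀ n : ℕ, Odd n → n.Coprime ((NumberField.discr K).natAbs * Ideal.absNorm 𝔪) → idealPow K ψ (Ideal.span {(n : 𝓞 K)}) = (jacobiSym (NumberField.discr K) n : ℂ) * (n : ℂ) ^ (2 - 1)) → (∀ (ℓ : ℕ) [Fact ℓ.Prime], ℓ ≠ p → W.HasGoodReductionAtPrime ℓ → ‖e.symm (∑ᶠ (w : HeightOneSpectrum (𝓞 K)) (_ : Ideal.absNorm w.asIdeal = ℓ), ψ w) - (W.frobeniusTrace ℓ : PadicAlgCl p)‖ < 1) →
            (∃ v : HeightOneSpectrum (𝓞 K), v.asIdeal = Ideal.span {(p : 𝓞 K)} ∧ Nat.card (𝓞 K ⧸ v.asIdeal) = p ^ 2) → ∀ (hnd : ¬ (p : ℤ) ∣ NumberField.discr K), ∀ (Φ : Multiplicative (AddAut (geomTorsion W p)) ≃* GL (Fin 2) (ZMod p)) (k : Subalgebra (ZMod p) (Matrix (Fin 2) (Fin 2) (ZMod p))) (e₀ : geomTorsion W p ≃+ (Fin 2 → ZMod p)), (∀ (g : Multiplicative (AddAut (geomTorsion W p))) (x : geomTorsion W p),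
              e₀ (Multiplicative.toAdd g x) = ((Φ g : GL (Fin 2) (ZMod p)) : Matrix (Fin 2) (Fin 2) (ZMod p)) *ᵥ e₀ x) → IsField k → Module.finrank (ZMod p) k = 2 → (letI : Module (ZMod p) (geomTorsion W p) := AddSubgroup.torsionBy.zmodModule ; ∀ g : Multiplicative (AddAut (geomTorsion W p)), Matrix.trace ((Φ g : GL (Fin 2) (ZMod p)) : Matrix (Fin 2) (Fin 2) (ZMod p)) = LinearMap.trace (ZMod p) (geomTorsion W p) ((Multiplicative.toAdd g).toAddMonoidHom.toZModLinearMap p)) →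
            (galoisRepTorsion W p).range.map Φ.toMonoidHom ≤ Subgroup.normalizer (Serre1972.unitGroup k : Set (GL (Fin 2) (ZMod p))) → ((Serre1972.unitGroup k).comap Φ.toMonoidHom).comap (galoisRepTorsion W p) ≤ (absGaloisRestrict ℚ K).toMonoidHom.range → (∀ τ : absoluteGaloisGroup K, Φ (galoisRepTorsion W p (absGaloisRestrict ℚ K τ)) ∈ Serre1972.unitGroup k) → ∀ (M : ℕ) [NeZero M] (g : CuspForm (Gamma0 M) 2) (ι : coeffField g →+* PadicAlgCl p) (Ω : ℂ),
            ¬ p ∣ M → IsNewform0 g → Literature.NumberTheory.Automorphic.IsCMForm (liftToGamma1 M 2 g) → cuspCoeff g p = 0 → IsCohomologicalPlusPeriod g ι Ω → (∀ ℓ : ℕ, ℓ.Prime → ¬ ℓ ∣ p * M * W.conductorNorm ℤ → ‖embCoeff g ι ℓ - (W.frobeniusTrace ℓ : PadicAlgCl p)‖ < 1) → (∀ ℓ : ℕ, ℓ.Prime → ¬ ℓ ∣ (NumberField.discr K).natAbs * Ideal.absNorm 𝔪 → embCoeff g ι ℓ = e.symm (∑ᶠ (w : HeightOneSpectrum (𝓞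 K)) (_ : Ideal.absNorm w.asIdeal = ℓ), ψ w)) →
            ∀ (κ : ZpExtension ℚ p) (γ : absoluteGaloisGroup ℚ), ∀ (hκ : κ.IsCyclotomic), κ.IsTopGenerator γ → IsCyclotomicVariable p γ → ∀ (S₀ : Finset (HeightOneSpectrum (𝓞 ℚ))), (∀ v ∈ S₀, ((p : ℕ) : 𝓞 ℚ) ∉ v.asIdeal) → (∀ v : HeightOneSpectrum (𝓞 ℚ), ¬ W.HasGoodReductionAt v → v ∈ S₀) → (∀ v : HeightOneSpectrum (𝓞 ℚ), natGenerator v ∣ M → v ∈ S₀) → ∀ (S : Set (PadicAlgCl p)) (θ : FramedGaloisRep K (padicCoeffIntegers S) 1) (γK : absoluteGaloisGroup K)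
              (j : (W.baseChange K).geomPrimaryTorsion p →+ (GreenbergSelmer.Cofree θ (padicCoeffField S))), ∀ (hS : 0 < Module.finrank ℚ_[p] (padicCoeffField S)), (∀ w : HeightOneSpectrum (𝓞 K), (p : 𝓞 K) ∉ w.asIdeal → ¬ 𝔪 ≤ w.asIdeal → θ.IsUnramifiedAt w ∧ ∃ P : Polynomial (padicCoeffIntegers S), P.map (padicCoeffIntegers S).subtype = X - C (e.symm (ψ w)) ∧ θ.HasFrobCharpolyAt w P) → ∀ (hγK : (κ.restrictOfFinrankEqTwo hp K hK2).IsTopGenerator γK),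
              (∀ v : HeightOneSpectrum (𝓞 K), (p : 𝓞 K) ∈ v.asIdeal → ∀ (δ : absoluteGaloisGroup (v.adicCompletion K)) (t : (W.baseChange K).geomPrimaryTorsion p), j (resGalOfEmb (closureEmb (K := K) (v.adicCompletion K)) δ • t) = resGalOfEmb (closureEmb (K := K) (v.adicCompletion K)) δ • j t) → Submodule.span (padicCoeffIntegers S) (Set.range j) = ⊤ → ∀ (Dψ : SmallImageCharSignedSelmer.SignedTransportDualDataSat (κ.restrictOfFinrankEqTwo hp K hK2) γK
                (GreenbergSelmer.Cofree θ (padicCoeffField S)) (padicCoeffIntegers S) (W.baseChange K) j {w : HeightOneSpectrum (𝓞 K) | ∃ v ∈ S₀, ((natGenerator v : ℕ) : 𝓞 K) ∈ w.asIdeal} ε), Module.Finite (IwasawaAlgebra p) Dψ.X → Module.IsTorsion (IwasawaAlgebra p) Dψ.X → ∀ L : IwasawaAlgebraO (Set.range ι), L ≠ 0 → (∀ n : ℕ, (Even n ↔ ε = 1) → IsCongrModOmegaO (Set.range ι) n ((mazurTateElementK g Ω p n).map ι)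
                (((((-1) ^ (n / 2 + 1) * (if ε = 1 then cyclotomicOmegaMinus p n else cyclotomicOmegaPlus p n)).map (Int.castRingHom (PadicAlgCl p)) : (PadicAlgCl p)[X]) : PowerSeries (PadicAlgCl p)) * iwasawaOToPowerSeries (Set.range ι) L)) → ∀ (vp : HeightOneSpectrum (𝓞 K)) (hv : vp.asIdeal = Ideal.span {((p : ℕ) : 𝓞 K)}), ∀ (κ₂ : ZpExtension K p) (γ₂ : absoluteGaloisGroup K) (𝔣 : Ideal (𝓞 K)) (χ₀ θ' : absoluteGaloisGroup K →ₜ* (↥(padicCoeffIntegers S))ˣ)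
                    (D₀ : Literature.NumberTheory.ComplexMultiplication.EllipticUnits.JohnsonLeungKings2011.TwistedIwasawaDataO S (κ.restrictOfFinrankEqTwo hp K hK2) κ₂ γK⁻¹ γ₂ χ₀ 𝔣 σK) (D₀' : Literature.NumberTheory.ComplexMultiplication.EllipticUnits.JohnsonLeungKings2011.IwasawaCohomologyDataO S (κ.restrictOfFinrankEqTwo hp K hK2) κ₂ γK⁻¹ γ₂ θ' 𝔣 0)
                    (D₁' : Literature.NumberTheory.ComplexMultiplication.EllipticUnits.JohnsonLeungKings2011.IwasawaCohomologyDataO S (κ.restrictOfFinrankEqTwo hp K hK2) κ₂ γK⁻¹ γ₂ θ' 𝔣 1) (D₂' : Literature.NumberTheory.ComplexMultiplication.EllipticUnits.JohnsonLeungKings2011.IwasawaCohomologyDataO S (κ.restrictOfFinrankEqTwo hp K hK2) κ₂ γK⁻¹ γ₂ θ' 𝔣 2) (hθfin : ∃ m : ℕ, 0 < m ∧ ∀ τ : absoluteGaloisGroup K, χ₀ τ ^ m = 1)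
                    (hker : ∀ τ ∈ ZpExtension.pairKer (κ.restrictOfFinrankEqTwo hp K hK2) κ₂, θ' τ = χ₀ τ) (hN : ∀ k : ℕ, ∀ τ ∈ ramificationSubgroup K (Literature.NumberTheory.ComplexMultiplication.EllipticUnits.JohnsonLeungKings2011.suppPF p 𝔣), ∃ b : ↥(padicCoeffIntegers S), ((θ' τ : (↥(padicCoeffIntegers S))ˣ) : ↥(padicCoeffIntegers S)) = (χ₀ τ : (↥(padicCoeffIntegers S))ˣ) + ((p : ↥(padicCoeffIntegers S))) ^ k * b)
                    (σ : Literature.NumberTheory.ComplexMultiplication.EllipticUnits.IwasawaAlgebraO₂ S ≃+* Literature.NumberTheory.ComplexMultiplication.EllipticUnits.IwasawaAlgebraO₂ S)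
                    (Dθ : Literature.NumberTheory.ComplexMultiplication.EllipticUnits.JohnsonLeungKings2011.ZetaSkeleton (Literature.NumberTheory.ComplexMultiplication.EllipticUnits.IwasawaAlgebraO₂ S) (Literature.NumberTheory.ComplexMultiplication.EllipticUnits.JohnsonLeungKings2011.AuxIdeals p 𝔣) D₀'.H D₁'.H D₂'.H) (a : Literature.NumberTheory.ComplexMultiplication.EllipticUnits.JohnsonLeungKings2011.AuxIdeals p 𝔣),

                      (γ₂ ∈ ((κ.restrictOfFinrankEqTwo hp K hK2)).kerSubgroup ∧ (∃ u₁ u₂ : ℤ_[p]ˣ, ZpExtension.IsTopGeneratorPair (((κ.restrictOfFinrankEqTwo hp K hK2)).unitTwist u₁) (κ₂.unitTwist u₂) γK⁻¹ γ₂) ∧ (∀ g : absoluteGaloisGroup K, ((θ' g : (↥(padicCoeffIntegers S))ˣ) : ↥(padicCoeffIntegers S)) * ((θ g : GL (Fin 1) ↥(padicCoeffIntegers S)) : Matrix (Fin 1) (Fin 1) ↥(padicCoeffIntegers S)) 0 0 = 1) ∧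
                        Module.Finite (Literature.NumberTheory.ComplexMultiplication.EllipticUnits.IwasawaAlgebraO₂ S) D₀.D1.H ∧ Module.Finite (Literature.NumberTheory.ComplexMultiplication.EllipticUnits.IwasawaAlgebraO₂ S) D₀.D2.H ∧ (D₀.toZetaSkeleton (D₀.nsub_regular hθfin)).Thm52Shape ∧
                        (∀ (r : Literature.NumberTheory.ComplexMultiplication.EllipticUnits.IwasawaAlgebraO₂ S) (x : D₀.D1.H), Summit.BirchSwinnertonDyer.BirchSwinnertonDyer.Theorems.SmallImageRttD2Twist.twistEquivOfKer S (κ.restrictOfFinrankEqTwo hp K hK2) κ₂ χ₀ θ' 𝔣 hker hN D₀.D1 D₁' (r • x) = σ r • Summit.BirchSwinnertonDyer.BirchSwinnertonDyer.Theorems.SmallImageRttD2Twist.twistEquivOfKer S (κ.restrictOfFinrankEqTwo hp K hK2) κ₂ χ₀ θ' 𝔣 hker hN D₀.D1 D₁' x) ∧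
                        (∀ a' : Literature.NumberTheory.ComplexMultiplication.EllipticUnits.JohnsonLeungKings2011.AuxIdeals p 𝔣, Summit.BirchSwinnertonDyer.BirchSwinnertonDyer.Theorems.SmallImageRttD2Twist.twistEquivOfKer S (κ.restrictOfFinrankEqTwo hp K hK2) κ₂ χ₀ θ' 𝔣 hker hN D₀.D1 D₁' ((D₀.toZetaSkeleton (D₀.nsub_regular hθfin)).aZeta a') = Dθ.aZeta a') ∧
                        (∀ (r : Literature.NumberTheory.ComplexMultiplication.EllipticUnits.IwasawaAlgebraO₂ S) (x : D₀.D2.H), Summit.BirchSwinnertonDyer.BirchSwinnertonDyer.Theorems.SmallImageRttD2Twist.twistEquivOfKer S (κ.restrictOfFinrankEqTwo hp K hK2) κ₂ χ₀ θ' 𝔣 hker hN D₀.D2 D₂' (r • x) = σ r • Summit.BirchSwinnertonDyer.BirchSwinnertonDyer.Theorems.SmallImageRttD2Twist.twistEquivOfKer S (κ.restrictOfFinrankEqTwo hp K hK2) κ₂ χ₀ θ' 𝔣 hker hN D₀.D2 D₂' x) ∧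
                        (∀ (r : Literature.NumberTheory.ComplexMultiplication.EllipticUnits.IwasawaAlgebraO₂ S) (x : D₀.D0.H), Summit.BirchSwinnertonDyer.BirchSwinnertonDyer.Theorems.SmallImageRttD2Twist.twistEquivOfKer S (κ.restrictOfFinrankEqTwo hp K hK2) κ₂ χ₀ θ' 𝔣 hker hN D₀.D0 D₀' (r • x) = σ r • Summit.BirchSwinnertonDyer.BirchSwinnertonDyer.Theorems.SmallImageRttD2Twist.twistEquivOfKer S (κ.restrictOfFinrankEqTwo hp K hK2) κ₂ χ₀ θ' 𝔣 hker hN D₀.D0 D₀' x) ∧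
                        (∀ a' : Literature.NumberTheory.ComplexMultiplication.EllipticUnits.JohnsonLeungKings2011.AuxIdeals p 𝔣, Dθ.nsub a' = σ ((D₀.toZetaSkeleton (D₀.nsub_regular hθfin)).nsub a')) ∧ σ PowerSeries.X = (PowerSeries.C (PowerSeries.C (((χ₀ γK⁻¹ * (θ' γK⁻¹)⁻¹ : (↥(padicCoeffIntegers S))ˣ)) : ↥(padicCoeffIntegers S)) : PowerSeries ↥(padicCoeffIntegers S)) : Literature.NumberTheory.ComplexMultiplication.EllipticUnits.IwasawaAlgebraO₂ S) * (1 + PowerSeries.X) - 1 ∧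
                        σ (PowerSeries.C (PowerSeries.X : PowerSeries ↥(padicCoeffIntegers S))) = (PowerSeries.C (PowerSeries.C (((χ₀ γ₂ * (θ' γ₂)⁻¹ : (↥(padicCoeffIntegers S))ˣ)) : ↥(padicCoeffIntegers S)) : PowerSeries ↥(padicCoeffIntegers S)) : Literature.NumberTheory.ComplexMultiplication.EllipticUnits.IwasawaAlgebraO₂ S) *
                            (1 + (PowerSeries.C (PowerSeries.X : PowerSeries ↥(padicCoeffIntegers S)) : Literature.NumberTheory.ComplexMultiplication.EllipticUnits.IwasawaAlgebraO₂ S)) - 1 ∧ (∀ c : ↥(padicCoeffIntegers S), σ (PowerSeries.C (PowerSeries.C c : PowerSeries ↥(padicCoeffIntegers S))) = PowerSeries.C (PowerSeries.C c : PowerSeries ↥(padicCoeffIntegers S))) ∧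
                        Submodule.torsionBy (Literature.NumberTheory.ComplexMultiplication.EllipticUnits.IwasawaAlgebraO₂ S) D₁'.H (PowerSeries.C (PowerSeries.X - PowerSeries.C (0 : ↥(padicCoeffIntegers S)) : PowerSeries ↥(padicCoeffIntegers S)) : Literature.NumberTheory.ComplexMultiplication.EllipticUnits.IwasawaAlgebraO₂ S) = ⊥ ∧ IsUnit (Summit.BirchSwinnertonDyer.BirchSwinnertonDyer.Theorems.SmallImageRttD2J2.phi0 S (Dθ.nsub a)))
                      →
                          ((∀ w ∈ Literature.NumberTheory.ComplexMultiplication.EllipticUnits.JohnsonLeungKings2011.suppPF p 𝔣, ((p : ℕ) : 𝓞 K) ∉ w.asIdeal → ∃ 𝔓 ∈ w.primesAbove, ∃ τ ∈ 𝔓.inertia (absoluteGaloisGroup K), θ' τ ≠ 1) ∧ (∀ w : HeightOneSpectrum (𝓞 K), w ∉ Literature.NumberTheory.ComplexMultiplication.EllipticUnits.JohnsonLeungKings2011.suppPF p 𝔣 → ∀ 𝔓 ∈ w.primesAbove, ∀ τ ∈ 𝔓.inertia (absoluteGaloisGroup K), θ' τ = 1))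
                          → ∀ (hθ'θ : ∀ g : absoluteGaloisGroup K, ((θ' g : (↥(padicCoeffIntegers S))ˣ) : ↥(padicCoeffIntegers S)) * ((θ g : GL (Fin 1) ↥(padicCoeffIntegers S)) : Matrix (Fin 1) (Fin 1) ↥(padicCoeffIntegers S)) 0 0 = 1)
                  (hNP : ∀ n : ℕ, ramificationSubgroup K (Literature.NumberTheory.ComplexMultiplication.EllipticUnits.JohnsonLeungKings2011.suppPF p 𝔣) ≤ (κ.restrictOfFinrankEqTwo hp K hK2).layerSubgroup n), ∀ (I : SmallImageRttD2J1.CycIwasawaCohomologyDataO S (κ.restrictOfFinrankEqTwo hp K hK2) γK⁻¹ θ' (Literature.NumberTheory.ComplexMultiplication.EllipticUnits.JohnsonLeungKings2011.suppPF p 𝔣) 1),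
                      (letI := SmallImageRttD2Seq.localAction (closureEmb (K := K) (vp.adicCompletion K)) (GreenbergSelmer.Cofree θ (padicCoeffField S)) ;
                      haveI := SmallImageRttD2Seq.smulCommClass_localAction (R := padicCoeffIntegers S) (GreenbergSelmer.Cofree θ (padicCoeffField S)) vp ;
                      letI : Algebra (IwasawaAlgebra p) (IwasawaAlgebraO S) := (iwasawaToIwasawaO S).toAlgebra ;
                      haveI : FiniteDimensional ℚ_[p] (padicCoeffField S) := Module.finite_of_finrank_pos hS ;
                      letI := I.moduleIwasawa ;
                      haveI := I.isScalarTower_moduleIwasawa ; ∀ (lam : ↥(padicCoeffIntegers S) →+ ℤ_[p]) (hlam : ∀ (c : ℤ_[p]) (y : ↥(padicCoeffIntegers S)), lam (padicIntToCoeffIntegers S c * y) = c * lam y), (∀ (m : ℕ) (t : ↥(padicCoeffIntegers S)), (∀ b : ↥(padicCoeffIntegers S), SmallImageRttD2Seq.lamZMod S lam m (b * t) = 0) → t ∈ Ideal.span {((p : ℕ) : ↥(padicCoeffIntegers S)) ^ m}) →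
                        (∀ (m : ℕ) (g : ↥(padicCoeffIntegers S) →+ ZMod (p ^ m)), ∃ t : ↥(padicCoeffIntegers S), ∀ b : ↥(padicCoeffIntegers S), g b = SmallImageRttD2Seq.lamZMod S lam m (b * t)) → ∀ (γv : absoluteGaloisGroup (vp.adicCompletion K)) (hγv : (κ.restrictOfFinrankEqTwo hp K hK2).IsTopGenerator (resGalOfEmb (closureEmb (K := K) (vp.adicCompletion K)) γv))
                        (DQ : SmallImageRttD2Seq.LocalCondDualData (κ.restrictOfFinrankEqTwo hp K hK2) (GreenbergSelmer.Cofree θ (padicCoeffField S)) ↥(padicCoeffIntegers S) (W.baseChange K) j ε vp γv) (instX : Module (IwasawaAlgebraO S) Dψ.X) (instQ : Module (IwasawaAlgebraO S) DQ.X) (hιX : ∀ (f : IwasawaAlgebra p) (x : Dψ.X), (letI := instX; iwasawaToIwasawaO S f • x) = f • x) (hιQ : ∀ (f : IwasawaAlgebra p) (x : DQ.X), (letI := instQ; iwasawaToIwasawaO S f • x) = f • x)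
                        (hCX : ∀ (a₁ : ↥(padicCoeffIntegers S)) (x : Dψ.X) (s₁ : SmallImageCharSignedSelmer.signedTransportSelmerInftySat (κ.restrictOfFinrankEqTwo hp K hK2) (GreenbergSelmer.Cofree θ (padicCoeffField S)) ↥(padicCoeffIntegers S) (W.baseChange K) j {w : HeightOneSpectrum (𝓞 K) | ∃ v ∈ S₀, ((natGenerator v : ℕ) : 𝓞 K) ∈ w.asIdeal} ε), Dψ.toDual (letI := instX; (PowerSeries.C a₁ : IwasawaAlgebraO S) • x) s₁ = Dψ.toDual x ⟨GreenbergSelmer.scalarH1 _ _ a₁ s₁,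
                              SmallImageCharSignedSelmer.scalarH1_mem_signedTransportSelmerInftySat _ _ ↥(padicCoeffIntegers S) (W.baseChange K) j {w : HeightOneSpectrum (𝓞 K) | ∃ v ∈ S₀, ((natGenerator v : ℕ) : 𝓞 K) ∈ w.asIdeal} ε a₁ s₁.2⟩) (hCQ : ∀ (a₁ : ↥(padicCoeffIntegers S)) (x : DQ.X) (c : SmallImageRttD2Seq.localCondInftySat (κ.restrictOfFinrankEqTwo hp K hK2) (GreenbergSelmer.Cofree θ (padicCoeffField S)) ↥(padicCoeffIntegers S) (W.baseChange K) j ε vp),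
                          DQ.toDual (letI := instQ; (PowerSeries.C a₁ : IwasawaAlgebraO S) • x) c = DQ.toDual x (SmallImageRttD2Seq.scalarLocalSat _ _ ↥(padicCoeffIntegers S) (W.baseChange K) j ε vp a₁ c)) (hγB : γK⁻¹ * resGalOfEmb (closureEmb (K := K) (vp.adicCompletion K)) γv ∈ (κ.restrictOfFinrankEqTwo hp K hK2).kerSubgroup),
                        letI := instX; letI := instQ ;
                        haveI : IsScalarTower (IwasawaAlgebra p) (IwasawaAlgebraO S) Dψ.X := SmallImageRttCharRoad.isScalarTower_iwasawaAlgebraO_of_smul_eq S (fun _ ↦ rfl) hιX ;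
                        haveI : IsScalarTower (IwasawaAlgebra p) (IwasawaAlgebraO S) DQ.X := SmallImageRttCharRoad.isScalarTower_iwasawaAlgebraO_of_smul_eq S (fun _ ↦ rfl) hιQ ;
                        let gX := SmallImageRttD2Seq.gXLinearMapO S Dψ DQ (fun _ _ ↦ rfl) (SmallImageRttD2Seq.natCast_mem_asIdeal_of_eq_span hv) instX instQ hιX hιQ hCX hCQ (GreenbergSelmer.exists_pow_smul_cofree_eq_zero S θ) (GreenbergSelmer.isOpen_stabilizer_cofree S θ) (SmallImageRttD2Seq.isOpen_stabilizer_of_hres (GreenbergSelmer.Cofree θ (padicCoeffField S)) vp (fun _ _ ↦ rfl) (GreenbergSelmer.isOpen_stabilizer_cofree S θ)) hγK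
                              (SmallImageRttD2Seq.isNonsplitIn_restrictOfFinrankEqTwo hp hκ K hK2 hnd (SmallImageRttD2Seq.natCast_mem_asIdeal_of_eq_span hv)) hγv; ∀ jv : I.H →ₗ[IwasawaAlgebraO S] DQ.X, (∀ b : I.H, DQ.toDual (jv b) = ((SmallImageRttD2Seq.layerPairingOf S (κ.restrictOfFinrankEqTwo hp K hK2) θ' (Literature.NumberTheory.ComplexMultiplication.EllipticUnits.JohnsonLeungKings2011.suppPF p 𝔣) vp (GreenbergSelmer.Cofree θ (padicCoeffField S))
                                (SmallImageRttD2Seq.isOpen_stabilizer_of_hres (GreenbergSelmer.Cofree θ (padicCoeffField S)) vp (fun _ _ ↦ rfl) (GreenbergSelmer.isOpen_stabilizer_cofree S θ)) (SmallImageRttD2Seq.cofreeLamCoeffPairing S lam hlam θ' (Literature.NumberTheory.ComplexMultiplication.EllipticUnits.JohnsonLeungKings2011.suppPF p 𝔣) vp θ (fun _ _ ↦ rfl)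
                                  (SmallImageRttD2Seq.isOpen_stabilizer_of_hres (GreenbergSelmer.Cofree θ (padicCoeffField S)) vp (fun _ _ ↦ rfl) (GreenbergSelmer.isOpen_stabilizer_cofree S θ)) hθ'θ) (GreenbergSelmer.exists_pow_smul_cofree_eq_zero S θ) γK⁻¹ γv hγB hNP (SmallImageRttD2Seq.isNonsplitIn_restrictOfFinrankEqTwo hp hκ K hK2 hnd (SmallImageRttD2Seq.natCast_mem_asIdeal_of_eq_span hv))
                                (SmallImageRttD2Seq.cofreeLamCoeffPairing_hPred S lam hlam θ' (Literature.NumberTheory.ComplexMultiplication.EllipticUnits.JohnsonLeungKings2011.suppPF p 𝔣) vp θ (fun _ _ ↦ rfl) (SmallImageRttD2Seq.isOpen_stabilizer_of_hres (GreenbergSelmer.Cofree θ (padicCoeffField S)) vp (fun _ _ ↦ rfl) (GreenbergSelmer.isOpen_stabilizer_cofree S θ)) hθ'θ)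
                                (SmallImageRttD2Seq.cofreeLamCoeffPairing_hPsc S lam hlam θ' (Literature.NumberTheory.ComplexMultiplication.EllipticUnits.JohnsonLeungKings2011.suppPF p 𝔣) vp θ (fun _ _ ↦ rfl) (SmallImageRttD2Seq.isOpen_stabilizer_of_hres (GreenbergSelmer.Cofree θ (padicCoeffField S)) vp (fun _ _ ↦ rfl) (GreenbergSelmer.isOpen_stabilizer_cofree S θ)) hθ'θ)).towerPairing I).pairing
                              (SmallImageRttD2Seq.isOpen_stabilizer_of_hres (GreenbergSelmer.Cofree θ (padicCoeffField S)) vp (fun _ _ ↦ rfl) (GreenbergSelmer.isOpen_stabilizer_cofree S θ)) b) → Function.Exact (jv ∘ₗ (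
                                  (SmallImageRttD2Seq.strictCarrier I (SmallImageRttD2Seq.strictLevel S (κ.restrictOfFinrankEqTwo hp K hK2) θ' (Literature.NumberTheory.ComplexMultiplication.EllipticUnits.JohnsonLeungKings2011.suppPF p 𝔣) {w : HeightOneSpectrum (𝓞 K) | ∃ v ∈ S₀, ((natGenerator v : ℕ) : 𝓞 K) ∈ w.asIdeal})
                                    (fun n k f _ hy ↦ SmallImageRttD2Seq.smul_mem_strictLevel S (κ.restrictOfFinrankEqTwo hp K hK2) θ' (Literature.NumberTheory.ComplexMultiplication.EllipticUnits.JohnsonLeungKings2011.suppPF p 𝔣) {w : HeightOneSpectrum (𝓞 K) | ∃ v ∈ S₀, ((natGenerator v : ℕ) : 𝓞 K) ∈ w.asIdeal} γK⁻¹ n k f hy))).subtype) gX)) := by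
  intro hKP W _ _ p _ hp hX7 hncm hap hns hT1 hT1u ε K _ _ σK 𝔪 ψ e hK2 htc h𝔪 hnormI hcop hbad hψ hψpow hcongrW hinert hnd Φ k e₀ hΦ hkf hk2 htr hnorm hUK hUθ M _ g ι Ω hpM hng hcm hapg hΩ hcoeffW hcoeffψ κ γ hκ hγ hcv S₀ hS₀p hS₀bad hS₀M S θ γK j hS hθ hγK hj hjspan Dψ hfin htor L hL hcongr vp hv κ₂ γ₂ 𝔣 χ₀ θ' D₀ D₀' D₁' D₂' hθfin hkerχ hNχ σ Dθ a hframe hsupp hθ'θ hNP I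
  haveI : IsTotallyComplex K := htc
  haveI : FiniteDimensional ℚ_[p] (padicCoeffField S) := Module.finite_of_finrank_pos hS
  letI : Algebra (IwasawaAlgebra p) (IwasawaAlgebraO S) := (iwasawaToIwasawaO S).toAlgebra
  letI := SmallImageRttD2Seq.localAction (closureEmb (K := K) (vp.adicCompletion K)) (GreenbergSelmer.Cofree θ (padicCoeffField S))
  haveI := SmallImageRttD2Seq.smulCommClass_localAction (R := padicCoeffIntegers S) (GreenbergSelmer.Cofree θ (padicCoeffField S)) vp
  letI := I.moduleIwasawa
  haveI := I.isScalarTower_moduleIwasawa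
  obtain ⟨hR, hU⟩ := hsupp
  intro lam hlam hInj hSurj γv hγv DQ instX instQ hιX hιQ hCX hCQ hγB gX jv hjv
  exact SmallImageRttD2Seq.exact_junctionMap_comp_subtype_cofree_lam_of_lamPerfect S lam hlam θ Dψ DQ (fun _ _ ↦ rfl)
    (SmallImageRttD2Seq.natCast_mem_asIdeal_of_eq_span hv) I
    (SmallImageRttD2Seq.isOpen_stabilizer_of_hres (GreenbergSelmer.Cofree θ (padicCoeffField S)) vp (fun _ _ ↦ rfl) (GreenbergSelmer.isOpen_stabilizer_cofree S θ))
    hθ'θ (GreenbergSelmer.exists_pow_smul_cofree_eq_zero S θ) hγB hNP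
    (SmallImageRttD2Seq.isNonsplitIn_restrictOfFinrankEqTwo hp hκ K hK2 hnd (SmallImageRttD2Seq.natCast_mem_asIdeal_of_eq_span hv))
    rfl instX instQ hιX hιQ hCX hCQ (GreenbergSelmer.isOpen_stabilizer_cofree S θ) hγK hγv
    (SmallImageRttD2Seq.finite_suppPF_of_ne_bot (SmallImageRttCharRoadJ2.ne_bot_of_auxIdeals a))
    (SmallImageRttD2Seq.finite_placesAboveFinset S₀)
    (SmallImageRttD2Seq.eq_of_mem_suppPF_of_not_mem_placesAboveFinset S θ W S₀ hS₀bad hbad (fun w hw h𝔪 ↦ (hθ w hw h𝔪).1) hv hθ'θ hR)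
    (SmallImageRttD2Seq.eq_of_natCast_mem_asIdeal_of_eq_span hv)
    (SmallImageRttD2Seq.forall_smul_cofree_eq_of_frameSupp S θ hθ'θ hU)
    (SmallImageRttD2Seq.not_mem_placesAboveFinset_of_eq_span S₀ hS₀p hv)
    (SmallImageRttD2Seq.mem_suppPF_of_eq_span 𝔣 hv)
    (SmallImageRttD2Seq.frame_eq_one_of_mem_ramificationSubgroup S hU)
    hInj hSurj jv hjv
end Summit.BirchSwinnertonDyer.BirchSwinnertonDyer.Theorems.SmallImageRttLine

end
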